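/-
Copyright (c) 2026 the pub-hodgecm-mathlib formalisation cell (harness21).  Prover seat hodgecm-mathlib-K2Liu-p08 (g4), Track B «K2-LIT» ∕ hLiu418
#184♮, socket #42S organ S1 (ROAD W), brick F8 (T3-frame-split, reading half) (LEAD F0P6-plan (g14) BATCH #6 (4) «F8 = (T3-split) + (T4-split) =»;
K2Liu-p01 (g8) (T3a) p860022 place-generic over `LocalRing L v`).  2026-09-04.  KERNEL: theorems only.
-/
import Literature.NumberTheory.Automorphic.UnitaryGroupDoubledBigCellNonsplit   -- ★ `conjLocal_conjLocal` (σ ∘ σ = id on E ⊗ F_v)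
import Literature.NumberTheory.Automorphic.UnitaryGroupSplitPlace               -- ★ `PlacesOver.eq_or_eq_galInv`, `PlacesOver.galInv_ne`
import Mathlib.LinearAlgebra.Matrix.Hermitian
import HarnessLib

/-!
# Crux `HLiu418`, #42S-S1 ROAD W, brick F8 (T3-frame-split, reading half): THE `(w₀, w̄₀)`-READING OF `E ⊗ F_v` AT A SPLIT PLACE

Cell `hodgecm-mathlib`, crux item hLiu418 = `stmt-HodgeConjecture-24832` (helper lane `--supports … --as helper`, count-neutral).  THEOREMS ONLY (no `def`, no instance,
no notation, no named-fact hypothesis, no `sorry`).  At a place `v` of `F` SPLIT in the quadratic extension `E` (a place `w₀ ∣ v` with `c • w₀ ≠ w₀`), the local ring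
`E ⊗ F_v = LocalRing E v = Π_{w ∣ v} E_w` has exactly the two factors `w₀, w̄₀ = c⁻¹ • w₀`, and the READING
`ρ : z ↦ (z′, z″) := (z(w₀), (σz)(w₀)) = (z(w₀), c_*(z(w̄₀))) ∈ E_{w₀} × E_{w₀}`  (`σ = conjLocal E c v = c ⊗ 1`)
— the Mathlib term `(Pi.evalRingHom _ w₀).prod ((Pi.evalRingHom _ w₀).comp (conjLocal E c v))`, no `def` — is a ring isomorphism carrying `σ` to the SWAP and integrality ∕ `𝔪^m`-conditions
at both places to the same conditions on the two components.  This is the half of the split frame step (T3-frame-split) that differs from K2Liu-p01 (g8)'s inert frame (one place `w`,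
`O = 𝒪_w`): downstream, the twelve `𝒪_{w₀}`-coordinates `(B″, B′, A′, A″, C′, C″)` of ★ (T3-core-split) `K2LiuLatticePairCellCountSplit` are `X′ = ρ(X).1`, `X″ = ρ(X).2`, and the hermitian
Gram `G = A σ(B)ᵀ + B σ(A)ᵀ + d·C σ(C)ᵀ` of ★ (T3a) reads `ρ(G_{ij}).1 = K_{ij}`, `ρ(G_{ij}).2 = K_{ji}` with `K = A′B″ᵀ + B′A″ᵀ + d·C′C″ᵀ` (§3).
* §1 `reading_fst ∕ reading_snd` (components), `reading_conjLocal` (`ρ ∘ σ = swap ∘ ρ`), `reading_injective`, `reading_surjective`, `valued_reading_snd` (`v_{w₀}(z″) = v_{w̄₀}(z(w̄₀))`),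
  **`forall_valued_le_iff`** («`∀ w ∣ v, v_w(z(w)) ≤ r`» ↔ «`v(z′) ≤ r ∧ v(z″) ≤ r`», any `r`: boxes and `𝔪^m`-conditions read componentwise);
* §2 `reading_mul_conjLocal` (`ρ(x·σy) = (x′y″, x″y′)`), `reading_algebraMap` (a base scalar `d ∈ F_v` reads `(d, d)`);
* §3 **`reading_gram_fst ∕ reading_gram_snd`**: for `A B C : Fin 2 → LocalRing E v` and a `σ`-fixed `d`, `ρ(G i j) = (K i j, K j i)`; hence **`forall_valued_gram_le_iff`**:
  «`∀ i j, ∀ w, v_w((G i j)(w)) ≤ r`» ↔ «`∀ i j, v(K i j) ≤ r`».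
[CasselsFrohlichANT1967, Ch. II §10–§11, Ch. VII §1.1] [Shimura1997, §13.2].
HONEST LABEL.  Count-neutral helper; `HC_CM` is proved only modulo the 7 printed citations (2 remaining named inputs: hLiu418 = `stmt-HodgeConjecture-24832`,
h413 = `stmt-HodgeConjecture-24833`) until rung 0 closes.  NOT here: the passage `E_{w₀} ⊇ 𝒪_{w₀} →` ★ (T3-core-split)'s abstract DVR `O` (plain `Subtype`∕`adicCompletionIntegers`
bookkeeping at the (T4-split) call site) and the character duality (T3-frame)(i) (K2Liu-p01 (g8), place-generic for unramified `v`).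

## References
* [CasselsFrohlichANT1967] J. W. S. Cassels, A. Fröhlich (eds.), *Algebraic Number Theory* (1967), Ch. II §10–§11, Ch. VII §1.1.
* [Shimura1997] G. Shimura, *Euler products and Eisenstein series*, CBMS 93 (1997), §13.2.
-/

set_option autoImplicit false
set_option linter.dupNamespace false -- the mandated namespace repeats `HodgeConjecture.HodgeConjecture`

open Matrix
open Literature.NumberTheory.Automorphic Literature.NumberTheory.Automorphic.UnitaryGroup

namespace Summit.HodgeConjecture.HodgeConjecture.Cruxes.HLiu418.K2LiuLocalRingSplitReading

variable {F E : Type} [Field F] [NumberField F] [Field E] [NumberField E] [Algebra F E] [Algebra.IsQuadraticExtension F E]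
  (c : E ≃ₐ[F] E) {δ : E} (hcδ : c δ = -δ) (hδ : δ ≠ 0) (v : IsDedekindDomain.HeightOneSpectrum (NumberField.RingOfIntegers F))
  (w₀ : PlacesOver E v) (hw₀ : c • w₀.1 ≠ w₀.1)

/-! ## §1 The reading is a ring isomorphism carrying `σ` to the swap -/

omit [Algebra.IsQuadraticExtension F E] in
/-- first component of the reading: `z′ = z(w₀)`. [folklore] -/
theorem reading_fst (z : LocalRing E v) :
    (((Pi.evalRingHom _ w₀).prod ((Pi.evalRingHom _ w₀).comp (conjLocal E c v))) z).1 = z w₀ := rfl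

omit [Algebra.IsQuadraticExtension F E] in
/-- second component of the reading: `z″ = (σz)(w₀) = c_*(z(w̄₀))`. [cite: CasselsFrohlichANT1967, Ch. VII §1.1] -/
theorem reading_snd (z : LocalRing E v) :
    (((Pi.evalRingHom _ w₀).prod ((Pi.evalRingHom _ w₀).comp (conjLocal E c v))) z).2 =
      galAdicCompletionMap c (smul_inv_smul c w₀.1) (z (PlacesOver.galInv c w₀)) := rfl

include hcδ hδ in
/-- **`σ` reads as the SWAP**: `ρ(σz) = (z″, z′)` (★ `conjLocal_conjLocal`). [cite: CasselsFrohlichANT1967, Ch. VII §1.1] -/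
theorem reading_conjLocal (z : LocalRing E v) :
    ((Pi.evalRingHom _ w₀).prod ((Pi.evalRingHom _ w₀).comp (conjLocal E c v))) (conjLocal E c v z) =
      (((Pi.evalRingHom _ w₀).prod ((Pi.evalRingHom _ w₀).comp (conjLocal E c v))) z).swap := by
  refine Prod.ext rfl ?_
  show conjLocal E c v (conjLocal E c v z) w₀ = z w₀
  rw [conjLocal_conjLocal c v hcδ hδ]

omit [Algebra.IsQuadraticExtension F E] in
/-- the valuation of the second component: `v_{w₀}(z″) = v_{w̄₀}(z(w̄₀))` (★ `valued_galAdicCompletionMap`). [cite: CasselsFrohlichANT1967, Ch. VII §1.1] -/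
theorem valued_reading_snd (z : LocalRing E v) :
    Valued.v ((((Pi.evalRingHom _ w₀).prod ((Pi.evalRingHom _ w₀).comp (conjLocal E c v))) z).2) = Valued.v (z (PlacesOver.galInv c w₀)) := by
  rw [reading_snd, valued_galAdicCompletionMap]

include hw₀ in
/-- **the reading is injective**: a point of `Π_{w ∣ v} E_w` is determined by `z(w₀)` and `c_*(z(w̄₀))` (the places above a split `v` are `w₀, w̄₀`; `c_*` is injective).
[cite: CasselsFrohlichANT1967, Ch. II §10–§11] -/
theorem reading_injective :
    Function.Injective ((Pi.evalRingHom _ w₀).prod ((Pi.evalRingHom _ w₀).comp (conjLocal E c v)) : LocalRing E v → _) := by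
  have hc : c ≠ 1 := fun h => hw₀ (by rw [h, one_smul])
  intro z z' h
  have h1 : z w₀ = z' w₀ := congrArg Prod.fst h
  have h2 : galAdicCompletionMap c (smul_inv_smul c w₀.1) (z (PlacesOver.galInv c w₀)) =
      galAdicCompletionMap c (smul_inv_smul c w₀.1) (z' (PlacesOver.galInv c w₀)) := congrArg Prod.snd h
  have h2' : z (PlacesOver.galInv c w₀) = z' (PlacesOver.galInv c w₀) := (galAdicCompletionMap c (smul_inv_smul c w₀.1)).injective h2
  funext w
  rcases PlacesOver.eq_or_eq_galInv c hc w₀ w with rfl | rfl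
  · exact h1
  · exact h2'

include hcδ hδ hw₀ in
/-- **the reading is surjective**: every pair `(a, b) ∈ E_{w₀} × E_{w₀}` is `ρ(z)` — `c_* : E_{w̄₀} → E_{w₀}` is onto because `σ ∘ σ = id`. [cite: CasselsFrohlichANT1967, Ch. II §10–§11] -/
theorem reading_surjective :
    Function.Surjective ((Pi.evalRingHom _ w₀).prod ((Pi.evalRingHom _ w₀).comp (conjLocal E c v)) : LocalRing E v → _) := by
  classical
  have hne : PlacesOver.galInv c w₀ ≠ w₀ := PlacesOver.galInv_ne c w₀ hw₀
  rintro ⟨a, b⟩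
  -- `δ_{w₀}(b)` has `w₀`-component `b` and `w̄₀`-component `0`; `σ` of it has `w₀`-component `0`, and `σσ = id` returns `b`
  let za : LocalRing E v := Pi.single (M := fun w : PlacesOver E v => w.1.adicCompletion E) w₀ a
  let zb : LocalRing E v := Pi.single (M := fun w : PlacesOver E v => w.1.adicCompletion E) w₀ b
  have hza0 : za (PlacesOver.galInv c w₀) = 0 := Pi.single_eq_of_ne (M := fun w : PlacesOver E v => w.1.adicCompletion E) hne a
  have hzb0 : zb (PlacesOver.galInv c w₀) = 0 := Pi.single_eq_of_ne (M := fun w : PlacesOver E v => w.1.adicCompletion E) hne b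
  have hza : za w₀ = a := Pi.single_eq_same (M := fun w : PlacesOver E v => w.1.adicCompletion E) w₀ a
  have hzb : zb w₀ = b := Pi.single_eq_same (M := fun w : PlacesOver E v => w.1.adicCompletion E) w₀ b
  refine ⟨za + conjLocal E c v zb, Prod.ext ?_ ?_⟩
  · show (za + conjLocal E c v zb) w₀ = a
    rw [Pi.add_apply, conjLocal_apply]
    have h0 : zb ⟨c⁻¹ • w₀.1, under_inv_smul_eq c w₀⟩ = 0 := hzb0
    rw [h0, map_zero, add_zero, hza]
  · show conjLocal E c v (za + conjLocal E c v zb) w₀ = b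
    rw [map_add, conjLocal_conjLocal c v hcδ hδ, Pi.add_apply, conjLocal_apply]
    have h0 : za ⟨c⁻¹ • w₀.1, under_inv_smul_eq c w₀⟩ = 0 := hza0
    rw [h0, map_zero, zero_add, hzb]

include hw₀ in
/-- **INTEGRALITY ∕ `𝔪^m`-CONDITIONS READ COMPONENTWISE**: for any bound `r`, «`v_w(z(w)) ≤ r` at every `w ∣ v`» ↔ «`v(z′) ≤ r ∧ v(z″) ≤ r`».
[cite: CasselsFrohlichANT1967, Ch. II §10–§11] -/
theorem forall_valued_le_iff (z : LocalRing E v) (r : WithZero (Multiplicative ℤ)) :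
    (∀ w : PlacesOver E v, Valued.v (z w) ≤ r) ↔
      Valued.v ((((Pi.evalRingHom _ w₀).prod ((Pi.evalRingHom _ w₀).comp (conjLocal E c v))) z).1) ≤ r ∧
        Valued.v ((((Pi.evalRingHom _ w₀).prod ((Pi.evalRingHom _ w₀).comp (conjLocal E c v))) z).2) ≤ r := by
  have hc : c ≠ 1 := fun h => hw₀ (by rw [h, one_smul])
  rw [valued_reading_snd, reading_fst]
  constructor
  · exact fun h => ⟨h w₀, h _⟩
  · rintro ⟨h1, h2⟩ w
    rcases PlacesOver.eq_or_eq_galInv c hc w₀ w with rfl | rfl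
    · exact h1
    · exact h2

/-! ## §2 Products and base scalars -/

include hcδ hδ in
/-- `ρ(x·σy) = (x′·y″, x″·y′)`. [cite: CasselsFrohlichANT1967, Ch. VII §1.1] -/
theorem reading_mul_conjLocal (x y : LocalRing E v) :
    ((Pi.evalRingHom _ w₀).prod ((Pi.evalRingHom _ w₀).comp (conjLocal E c v))) (x * conjLocal E c v y) =
      ((((Pi.evalRingHom _ w₀).prod ((Pi.evalRingHom _ w₀).comp (conjLocal E c v))) x).1 *
          (((Pi.evalRingHom _ w₀).prod ((Pi.evalRingHom _ w₀).comp (conjLocal E c v))) y).2,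
        (((Pi.evalRingHom _ w₀).prod ((Pi.evalRingHom _ w₀).comp (conjLocal E c v))) x).2 *
          (((Pi.evalRingHom _ w₀).prod ((Pi.evalRingHom _ w₀).comp (conjLocal E c v))) y).1) := by
  rw [map_mul, reading_conjLocal c hcδ hδ]
  rfl

omit [Algebra.IsQuadraticExtension F E] in
/-- a `σ`-fixed scalar reads diagonally: `σ d = d ⇒ d″ = d′`. [folklore] -/
theorem reading_snd_of_conjLocal_eq {d : LocalRing E v} (hd : conjLocal E c v d = d) :
    (((Pi.evalRingHom _ w₀).prod ((Pi.evalRingHom _ w₀).comp (conjLocal E c v))) d).2 =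
      (((Pi.evalRingHom _ w₀).prod ((Pi.evalRingHom _ w₀).comp (conjLocal E c v))) d).1 := by
  show conjLocal E c v d w₀ = d w₀
  rw [hd]

/-! ## §3 The hermitian Gram of a lattice-pair point reads as `(K, Kᵀ)` -/

omit [Algebra.IsQuadraticExtension F E] in
/-- **FIRST COMPONENT OF THE GRAM**: with `X′ i = (X i)(w₀)`, `X″ i = (σ (X i))(w₀)` and a `σ`-fixed `d`,
`(A σ(B)ᵀ + B σ(A)ᵀ + d·C σ(C)ᵀ)_{ij}′ = (A′B″ᵀ + B′A″ᵀ + d′·C′C″ᵀ)_{ij}`. [cite: Shimura1997, §13.2] -/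
theorem reading_gram_fst {d : LocalRing E v} (A B C : Fin 2 → LocalRing E v) (i j : Fin 2) :
    ((vecMulVec A (fun k => conjLocal E c v (B k)) + vecMulVec B (fun k => conjLocal E c v (A k)) + d • vecMulVec C (fun k => conjLocal E c v (C k))) i j) w₀ =
      (vecMulVec (fun k => A k w₀) (fun k => conjLocal E c v (B k) w₀) + vecMulVec (fun k => B k w₀) (fun k => conjLocal E c v (A k) w₀) +
        d w₀ • vecMulVec (fun k => C k w₀) (fun k => conjLocal E c v (C k) w₀)) i j := by
  simp only [Matrix.add_apply, Matrix.smul_apply, Matrix.vecMulVec_apply, Pi.add_apply, Pi.mul_apply, smul_eq_mul]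

include hcδ hδ in
/-- **SECOND COMPONENT OF THE GRAM = TRANSPOSE**: `σ(G_{ij}) = G_{ji}` for a `σ`-fixed `d`, hence `(σ G_{ij})(w₀) = K_{ji}`. [cite: Shimura1997, §13.2] -/
theorem reading_gram_snd {d : LocalRing E v} (hd : conjLocal E c v d = d) (A B C : Fin 2 → LocalRing E v) (i j : Fin 2) :
    conjLocal E c v ((vecMulVec A (fun k => conjLocal E c v (B k)) + vecMulVec B (fun k => conjLocal E c v (A k)) +
        d • vecMulVec C (fun k => conjLocal E c v (C k))) i j) w₀ =
      (vecMulVec (fun k => A k w₀) (fun k => conjLocal E c v (B k) w₀) + vecMulVec (fun k => B k w₀) (fun k => conjLocal E c v (A k) w₀) +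
        d w₀ • vecMulVec (fun k => C k w₀) (fun k => conjLocal E c v (C k) w₀)) j i := by
  simp only [Matrix.add_apply, Matrix.smul_apply, Matrix.vecMulVec_apply, smul_eq_mul, map_add, map_mul, conjLocal_conjLocal c v hcδ hδ, hd, Pi.add_apply,
    Pi.mul_apply]
  ring

include hcδ hδ hw₀ in
/-- **THE GRAM CONDITION READS ON `K` ALONE**: for a `σ`-fixed `d` and any bound `r`,
«`∀ i j, ∀ w ∣ v, v_w(G_{ij}(w)) ≤ r`» ↔ «`∀ i j, v_{w₀}(K_{ij}) ≤ r`», `K = A′B″ᵀ + B′A″ᵀ + d′·C′C″ᵀ`. [cite: Shimura1997, §13.2] -/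
theorem forall_valued_gram_le_iff {d : LocalRing E v} (hd : conjLocal E c v d = d) (A B C : Fin 2 → LocalRing E v) (r : WithZero (Multiplicative ℤ)) :
    (∀ i j, ∀ w : PlacesOver E v,
        Valued.v (((vecMulVec A (fun k => conjLocal E c v (B k)) + vecMulVec B (fun k => conjLocal E c v (A k)) + d • vecMulVec C (fun k => conjLocal E c v (C k))) i j) w) ≤ r) ↔
      ∀ i j, Valued.v ((vecMulVec (fun k => A k w₀) (fun k => conjLocal E c v (B k) w₀) + vecMulVec (fun k => B k w₀) (fun k => conjLocal E c v (A k) w₀) +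
        d w₀ • vecMulVec (fun k => C k w₀) (fun k => conjLocal E c v (C k) w₀)) i j) ≤ r := by
  constructor
  · intro h i j
    rw [← reading_gram_fst c v w₀ A B C i j]
    exact h i j w₀
  · intro h i j
    rw [forall_valued_le_iff c v w₀ hw₀, reading_fst]
    refine ⟨?_, ?_⟩
    · rw [reading_gram_fst c v w₀ A B C i j]
      exact h i j
    · show Valued.v (conjLocal E c v _ w₀) ≤ r
      rw [reading_gram_snd c hcδ hδ v w₀ hd A B C i j]
      exact h j i

end Summit.HodgeConjecture.HodgeConjecture.Cruxes.HLiu418.K2LiuLocalRingSplitReading
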